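import Summits.Ventures.PercRepro.Night2ParallelReduction
import Summits.Ventures.PercRepro.Night2LocalFatOnly
import Summits.Ventures.PercRepro.Night2LocalOne

/-!
# PercRepro — the whole diagonal of the shadow form reduces to the local form at fat flats of simple matroids
(night-2, gen 11)

Induction on `q`: the row `q = 1` is `shadowHall_three_one` (every matroid); from the row `(q + 1, q − 1)` on
every matroid, the row `(q + 2, q)` follows on every matroid of rank `q + 2` by the parallel reduction
(`shadowHall_diag_of_simple`) once it holds on the loopless simple ones, where gen 9's `shadowHall_of_local_fat`
needs the local form (LI_G) at the rank-`(q+1)` flats `G` with `2 ≤ |E ∖ G| ≤ q` only; other ranks by truncation.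

* **`shadowHall_diag_of_local_fat_simple`**: if, for every `2 ≤ q' ≤ q`, the local form holds at every
  rank-`(q'+1)` flat `G` with `2 ≤ |E ∖ G| ≤ q'` of every loopless simple matroid of rank `q' + 2`, then
  `ShadowHall M (q + 2) q ((q+2)/(q+1))` holds for every finite matroid `M` — the diagonal of `ShadowC025`
  down to `q`, modulo the fat local forms of simple matroids (the regime `|E ∖ G| = q'` is a theorem for
  `q' ≤ 6`, `Night2LocalDQFour` / `DQFive` / `DQSix`; the thin regime `|E ∖ G| ≥ q' + 1` always).
-/

open scoped Matroid

namespace PercRepro.Shadow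

open Finset PerFlat ThmH

variable {α : Type} [DecidableEq α]

/-- `Φ(3, 1) = 3/2 = (1 + 2)/(1 + 1)`. -/
theorem phiK_three_one_ratio : phiK 3 1 = (((1 : ℕ) : ℚ) + 2) / (((1 : ℕ) : ℚ) + 1) := by
  rw [phiK_three_one]; norm_num

/-- A matroid of rank `≥ 2` in which any two distinct elements span rank `2` is loopless. -/
theorem indep_singleton_of_simple_of_two_le {M : Matroid α} [M.Finite]
    (hs : ∀ e ∈ gr M, ∀ f ∈ gr M, e ≠ f → rkN M {e, f} = 2) (hrk : ((2 : ℕ) : ℕ∞) ≤ M.eRank) :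
    ∀ e ∈ gr M, M.Indep {e} := by
  intro e he
  have h2 : 2 ≤ rkN M (gr M) := by
    have : M.eRk ((gr M : Finset α) : Set α) = M.eRank := by rw [coe_gr]; exact Matroid.eRk_ground M
    have h := hrk
    rw [← this, eRk_eq_rkN] at h
    exact_mod_cast h
  exact Matroid.indep_singleton.2 (isNonloop_of_simple hs h2 he)

/-- **The diagonal of the shadow form, down to `q`, from the fat local forms of simple matroids.** -/
theorem shadowHall_diag_of_local_fat_simple (q : ℕ) (hq : 1 ≤ q)
    (hloc : ∀ q', 2 ≤ q' → q' ≤ q → ∀ (N : Matroid α) [N.Finite],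
      (∀ e ∈ gr N, ∀ f ∈ gr N, e ≠ f → rkN N {e, f} = 2) → (∀ e ∈ gr N, N.Indep {e}) →
      N.eRank = ((q' + 2 : ℕ) : ℕ∞) →
      ∀ G ∈ flatsQ N (q' + 1), 2 ≤ (gr N \ G).card → (gr N \ G).card ≤ q' → LocalShadowHall N q' G)
    (M : Matroid α) [M.Finite] : ShadowHall M (q + 2) q (((q : ℚ) + 2) / ((q : ℚ) + 1)) := by
  induction q, hq using Nat.le_induction generalizing M with
  | base =>
    have h := shadowHall_three_one M
    rw [phiK_three_one_ratio] at h
    exact h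
  | succ n hn ih =>
    -- the rank-(n+3) case, by the parallel reduction with the row n on every matroid
    have hrank : ∀ (N : Matroid α) [N.Finite], N.eRank = ((n + 1 + 2 : ℕ) : ℕ∞) →
        ShadowHall N (n + 1 + 2) (n + 1) ((((n + 1 : ℕ) : ℚ) + 2) / (((n + 1 : ℕ) : ℚ) + 1)) := by
      intro N _ hN
      refine shadowHall_diag_of_simple (q := n + 1) (by omega) ?_ ?_ N hN
      · intro N' _
        have h := ih (fun q' h2 hq' => hloc q' h2 (by omega)) N'
        have hc : (((n : ℚ) + 2) / ((n : ℚ) + 1)) = ((((n + 1 : ℕ) : ℚ)) + 1) / ((n + 1 : ℕ) : ℚ) := by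
          push_cast; ring
        rw [hc] at h
        have heq : n + 1 - 1 = n := by omega
        rw [heq]
        exact h
      · intro N' _ hN' hs
        have hl : ∀ e ∈ gr N', N'.Indep {e} :=
          indep_singleton_of_simple_of_two_le hs (by rw [hN']; exact_mod_cast (by omega : 2 ≤ n + 1 + 2))
        have hrk : N'.eRk ((gr N' : Finset α) : Set α) = ((n + 1 + 2 : ℕ) : ℕ∞) := by
          rw [coe_gr, Matroid.eRk_ground]; exact hN'
        apply shadowHall_of_local_fat (q := n + 1) hrk
        intro G hG h2 hd
        exact hloc (n + 1) (by omega) le_rfl N' hs hl hN' G hG h2 hd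
    by_cases hlt : M.eRank < ((n + 1 + 2 : ℕ) : ℕ∞)
    · exact shadowHall_of_Uq_empty (Uq_eq_empty_of_eRank_lt hlt)
    · have hge : ((n + 1 + 2 : ℕ) : ℕ∞) ≤ M.eRank := not_lt.1 hlt
      apply shadowHall_of_truncate M (by omega : n + 1 < n + 1 + 2)
      apply hrank
      rw [Matroid.eRank_def, PercRepro.Matroid.truncate_ground, PercRepro.Matroid.truncate_eRk_eq_of_ge]
      rw [Matroid.eRk_ground]
      exact hge

end PercRepro.Shadow
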